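import Summits.AtomisticToContinuum.Crystallization.Theorems.ChartedZeroExcessLayeredLatticeLiouvilleUT

/-!
# Zero-excess layered lattice Liouville — part UU (lens-2 g57, node «DirichletSolve» 2/2): (HC) `HarmonicComparisonZ` PROVED.

`harmonicComparisonZ_holds : HarmonicComparisonZ` (UQ.2 VERBATIM), with `κ₁ := κ₀ / 2` and `ϱ₁ := max 1 ϱ₀(c₀, ε := κ₀)` from (T); finite-dimensional
Lax–Milgram [giaquinta1984 Ch. III, proof of Thm 2.2 (fn. 9) + energy identity (2.13)] over the objects of part UT.
MECHANISM.  (1) SUMMATION BY PARTS (`sum_inner_truncResidual_eq`): for `χ` supported in the finite set `P` and `ϱ ≥ 0`,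
`Σ_{X ∈ P} ⟪truncResidual χ X, χ X⟫ = −½ · Q_ϱ(χ)` (bond reversal symmetry `nearK_comm`, UT.1).  (2) With UT.5 (`truncForm_coercive`, ε := κ₀):
`(κ₀/2)·nnFormZ χ ≤ −Σ_{X ∈ P} ⟪truncResidual χ X, χ X⟫` (the KEY INEQUALITY).  (3) INJECTIVE ⇒ SURJECTIVE: `resOp g = 0` ⇒ `nnFormZ (extP g) = 0`
⇒ `extP g = 0` (UT.4 positivity) ⇒ `g = 0`; `LinearMap.surjective_of_injective` solves `resOp g = truncResidual φ |_P`, and `V := φ − extP g` is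
`ϱ`-truncated-harmonic on `P` (`HasSum` of the finitely supported residual family, `isTruncHarmonicZ_of_truncResidual_eq_zero`) and equals `φ` off `P`.
(4) ENERGY IDENTITY: `φ − V = extP g` and on `P` `truncResidual φ = truncResidual (extP g)`, so `|Σ_{X∈P} ⟪truncResidual φ X, φ X − V X⟫|
≥ (κ₀/2)·nnFormZ (φ − V) ≥ (κ₀/2)·idxEnergy (φ − V) (N₁ P)` (UT.4 `idxEnergy_le_nnFormZ`).  `IsTameIndexing` is not used.
LEAVES of [SBᵇ] after this part: (T) `TailDominationCert`, (LD) `LinearExcessDecayZ`, (RC) `EquilChartStrainP`, (I4ˢ) `TailFluxBSP`, hU, hN and the two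
typed glues (UR); struck so far: (I1) (UP), (PT) (US), (HC) (UU).  No statement of the column is re-typed here.
-/

noncomputable section

open scoped BigOperators InnerProductSpace RealInnerProductSpace
open MeasureTheory Set Metric Filter Topology
open Summit.AtomisticToContinuum.Crystallization.Theorems.ChartedPlanarOrderRigidityDoor (E3 IsNash atomsIn)
open Summit.AtomisticToContinuum.Crystallization.Theorems.ChartedPlanarOrderDensityDichotomy (μS IsSep nK nK_nonneg)
open Summit.AtomisticToContinuum.Crystallization.Theorems.ChartedPlanarOrderDoorLayered (Layered layeredHom_eq_layered)

namespace Summit.AtomisticToContinuum.Crystallization.Theorems.ChartedZeroExcessLayeredLatticeLiouville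

section DirichletSolve

variable {c : ℝ} {a b : E3} {w : ℤ → E3}

/-! ### UU.1  Summation by parts -/

/-- ★ SUMMATION BY PARTS: for `χ` supported in the finite set `N₀` (and `ϱ ≥ 0`),
`Σ_{X ∈ N₀} ⟪truncResidual χ X, χ X⟫ = −½ · Q_ϱ(χ)` (bond reversal symmetry `nearK_comm`). [this file, g57] -/
theorem sum_inner_truncResidual_eq (hc : 0 < c) (hL : IsLayeredCrystal c a b w) {ϱ : ℝ} {N₀ : Finset (Cell 2 × ℤ)}
    {χ : Cell 2 → ℤ → E3} (hχ : ∀ X : Cell 2 × ℤ, X ∉ N₀ → χ X.1 X.2 = 0) (hϱ : 0 ≤ ϱ) :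
    ∑ X ∈ N₀, ⟪truncResidual ϱ a b w χ X, χ X.1 X.2⟫_ℝ =
      -(1 / 2) * ∑ x ∈ nearSet hc hL ϱ N₀ ×ˢ nearSet hc hL ϱ N₀, nearFam ϱ a b w χ x := by
  set N := nearSet hc hL ϱ N₀ with hNdef
  have hsubN : N₀ ⊆ N := fun X hX => mem_nearSet_self hc hL hϱ hX
  have hNX : ∀ X ∈ N₀, ∀ Y : Cell 2 × ℤ, ‖lsite a b w Y.1 Y.2 - lsite a b w X.1 X.2‖ ≤ ϱ → Y ∈ N :=
    fun X hX Y hY => mem_nearSet_of hc hL hX hY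
  have h1a : ∑ X ∈ N₀, ⟪truncResidual ϱ a b w χ X, χ X.1 X.2⟫_ℝ =
      ∑ X ∈ N₀, ∑ Y ∈ N, ⟪nearK ϱ a b w X Y (χ Y.1 Y.2 - χ X.1 X.2), χ X.1 X.2⟫_ℝ :=
    Finset.sum_congr rfl fun X hX => by rw [truncResidual_eq_sum_nearK (hNX X hX), sum_inner]
  have h1b : ∑ X ∈ N₀, ∑ Y ∈ N, ⟪nearK ϱ a b w X Y (χ Y.1 Y.2 - χ X.1 X.2), χ X.1 X.2⟫_ℝ =
      ∑ X ∈ N, ∑ Y ∈ N, ⟪nearK ϱ a b w X Y (χ Y.1 Y.2 - χ X.1 X.2), χ X.1 X.2⟫_ℝ :=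
    Finset.sum_subset hsubN fun X _ hX => Finset.sum_eq_zero fun Y _ => by rw [hχ X hX, inner_zero_right]
  have h2 : ∑ x ∈ N ×ˢ N, nearFam ϱ a b w χ x =
      ∑ X ∈ N, ∑ Y ∈ N, ⟪nearK ϱ a b w X Y (χ Y.1 Y.2 - χ X.1 X.2), χ Y.1 Y.2⟫_ℝ -
        ∑ X ∈ N, ∑ Y ∈ N, ⟪nearK ϱ a b w X Y (χ Y.1 Y.2 - χ X.1 X.2), χ X.1 X.2⟫_ℝ := by
    rw [Finset.sum_product, ← Finset.sum_sub_distrib]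
    refine Finset.sum_congr rfl fun X _ => ?_
    rw [← Finset.sum_sub_distrib]
    refine Finset.sum_congr rfl fun Y _ => ?_
    unfold nearFam
    dsimp only
    rw [real_inner_comm (nearK ϱ a b w X Y (χ Y.1 Y.2 - χ X.1 X.2)) (χ Y.1 Y.2 - χ X.1 X.2), inner_sub_right]
  have h3 : ∑ X ∈ N, ∑ Y ∈ N, ⟪nearK ϱ a b w X Y (χ Y.1 Y.2 - χ X.1 X.2), χ Y.1 Y.2⟫_ℝ =
      -∑ X ∈ N, ∑ Y ∈ N, ⟪nearK ϱ a b w X Y (χ Y.1 Y.2 - χ X.1 X.2), χ X.1 X.2⟫_ℝ := by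
    conv_lhs => rw [Finset.sum_comm]
    rw [← Finset.sum_neg_distrib]
    refine Finset.sum_congr rfl fun p _ => ?_
    rw [← Finset.sum_neg_distrib]
    refine Finset.sum_congr rfl fun q _ => ?_
    rw [nearK_comm ϱ a b w p q, ← neg_sub (χ q.1 q.2) (χ p.1 p.2), nearK_neg, inner_neg_left]
  rw [h1a, h1b, h2, h3]
  ring

/-! ### UU.2  Truncated harmonicity from the residual -/

/-- Auxiliary step (`hasSum zero of tsum eq zero`). [formal bookkeeping] -/
theorem hasSum_zero_of_tsum_eq_zero {ι M : Type*} [AddCommMonoid M] [TopologicalSpace M] {f : ι → M} {s : Finset ι}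
    (hzero : ∀ i ∉ s, f i = 0) (ht : ∑' i, f i = 0) : HasSum f 0 := by
  have hs : HasSum f (∑ i ∈ s, f i) := hasSum_sum_of_ne_finset_zero hzero
  have ht' : ∑ i ∈ s, f i = 0 := (tsum_eq_sum hzero).symm.trans ht
  rw [ht'] at hs
  exact hs

/-- Auxiliary step (`isTruncHarmonicZ of truncResidual eq zero`). [formal bookkeeping] -/
theorem isTruncHarmonicZ_of_truncResidual_eq_zero (hc : 0 < c) (hL : IsLayeredCrystal c a b w) {ϱ : ℝ} {V : Cell 2 → ℤ → E3}
    {P : Set (Cell 2 × ℤ)} (h : ∀ X ∈ P, truncResidual ϱ a b w V X = 0) : IsTruncHarmonicZ ϱ a b w V P := by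
  intro X hX
  have hfin := finite_near_lsite hc hL X ϱ
  have hzero : ∀ Y ∉ hfin.toFinset, (if ϱ < ‖lsite a b w Y.1 Y.2 - lsite a b w X.1 X.2‖ then (0 : E3)
      else layeredKernel a b w (Y.1 - X.1) X.2 Y.2 (V Y.1 Y.2 - V X.1 X.2)) = 0 :=
    fun Y hY => if_pos (not_le.mp fun h' => hY (hfin.mem_toFinset.mpr h'))
  exact hasSum_zero_of_tsum_eq_zero hzero (h X hX)

/-! ### UU.3  ★ (HC) PROVED -/

/-- ★ **(HC) `HarmonicComparisonZ` HOLDS** (UQ.2): Dirichlet solvability + comparison energy identity for the `ϱ`-truncated linearised operator of a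
certified laminate, `κ₁ = κ₀/2`, `ϱ₁ = max 1 ϱ₀(c₀, κ₀)` from (T).  Finite-dimensional Lax–Milgram [giaquinta1984 Ch. III, proof of Thm 2.2];
`IsTameIndexing` is not used. [this file, g57] -/
theorem harmonicComparisonZ_holds : HarmonicComparisonZ := by
  intro hT κ₀ hκ₀ c₀ hc₀ C₁ _hC₁
  obtain ⟨ϱ₀, _hϱ₀, hT₀⟩ := hT c₀ hc₀ κ₀ hκ₀
  refine ⟨κ₀ / 2, by positivity, max 1 ϱ₀, le_max_left _ _, ?_⟩
  intro ϱ hϱ a b w hL _hTame hK P hP φ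
  have hϱ₀' : ϱ₀ ≤ ϱ := (le_max_right _ _).trans hϱ
  have hϱpos : 0 ≤ ϱ := zero_le_one.trans ((le_max_left _ _).trans hϱ)
  have hmemPf : ∀ X : Cell 2 × ℤ, X ∈ hP.toFinset ↔ X ∈ P := fun X => hP.mem_toFinset
  -- the KEY INEQUALITY for fields supported in P: κ₀/2 · nnFormZ χ ≤ −Σ_{X ∈ P} ⟪truncResidual χ X, χ X⟫
  have key : ∀ χ : Cell 2 → ℤ → E3, (∀ X : Cell 2 × ℤ, X ∉ hP.toFinset → χ X.1 X.2 = 0) →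
      κ₀ / 2 * nnFormZ χ ≤ -∑ X ∈ hP.toFinset, ⟪truncResidual ϱ a b w χ X, χ X.1 X.2⟫_ℝ := by
    intro χ hχ
    have hfs : HasFiniteSupport χ := ⟨hP.toFinset, fun γ m h => hχ (γ, m) h⟩
    have hTχ : Summable (tailFam ϱ a b w χ) ∧ ∑' x, tailFam ϱ a b w χ x ≤ κ₀ * nnFormZ χ := hT₀ ϱ hϱ₀' a b w hL χ hfs
    have hco := truncForm_coercive hc₀ hL hK hχ hTχ
    rw [sum_inner_truncResidual_eq hc₀ hL hχ hϱpos]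
    nlinarith [hco]
  -- the Dirichlet operator on P is injective …
  have hinj : Function.Injective (resOp hc₀ hL ϱ hP.toFinset) := by
    refine (injective_iff_map_eq_zero _).mpr fun g hg => ?_
    have hχ : ∀ X : Cell 2 × ℤ, X ∉ hP.toFinset → extP hP.toFinset g X.1 X.2 = 0 := fun X hX => extP_apply_of_not_mem g hX
    have hS : ∑ X ∈ hP.toFinset, ⟪truncResidual ϱ a b w (extP hP.toFinset g) X, extP hP.toFinset g X.1 X.2⟫_ℝ = 0 := by
      refine Finset.sum_eq_zero fun X hX => ?_
      have h0 : truncResidual ϱ a b w (extP hP.toFinset g) X = 0 := by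
        have := congrFun hg ⟨X, hX⟩
        rw [resOp_apply] at this
        exact this
      rw [h0, inner_zero_left]
    have hk := key _ hχ
    rw [hS, neg_zero] at hk
    have hnn : nnFormZ (extP hP.toFinset g) = 0 :=
      le_antisymm (by nlinarith [hk, nnFormZ_nonneg (extP hP.toFinset g)]) (nnFormZ_nonneg _)
    funext p
    have hp := eq_zero_of_nnFormZ_eq_zero hχ hnn (p : Cell 2 × ℤ)
    rw [extP_apply_of_mem g p.2] at hp
    exact hp
  -- … hence surjective: solve `resOp g = truncResidual φ |_P`
  obtain ⟨g, hg⟩ := LinearMap.surjective_of_injective hinj fun p => truncResidual ϱ a b w φ (p : Cell 2 × ℤ)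
  have hψ0 : ∀ X : Cell 2 × ℤ, X ∉ hP.toFinset → extP hP.toFinset g X.1 X.2 = 0 := fun X hX => extP_apply_of_not_mem g hX
  have hRψ : ∀ X ∈ hP.toFinset, truncResidual ϱ a b w (extP hP.toFinset g) X = truncResidual ϱ a b w φ X := fun X hX => by
    have := congrFun hg ⟨X, hX⟩
    rw [resOp_apply] at this
    exact this
  refine ⟨φ - extP hP.toFinset g, fun X hX => ?_, ?_, ?_⟩
  · -- V = φ off P
    simp only [Pi.sub_apply]
    rw [hψ0 X (fun h => hX ((hmemPf X).mp h)), sub_zero]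
  · -- V is ϱ-truncated-harmonic on P
    refine isTruncHarmonicZ_of_truncResidual_eq_zero hc₀ hL fun X hX => ?_
    rw [truncResidual_sub hc₀ hL, hRψ X ((hmemPf X).mpr hX), sub_self]
  · -- the comparison energy identity
    rw [sub_sub_cancel, finsum_mem_eq_finite_toFinset_sum _ hP]
    have hS : ∑ X ∈ hP.toFinset, ⟪truncResidual ϱ a b w φ X, φ X.1 X.2 - (φ - extP hP.toFinset g) X.1 X.2⟫_ℝ =
        ∑ X ∈ hP.toFinset, ⟪truncResidual ϱ a b w (extP hP.toFinset g) X, extP hP.toFinset g X.1 X.2⟫_ℝ := by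
      refine Finset.sum_congr rfl fun X hX => ?_
      rw [hRψ X hX]
      congr 1
      simp only [Pi.sub_apply]
      abel
    rw [hS]
    have hk := key _ hψ0
    have hidx := idxEnergy_le_nnFormZ hψ0 {X : Cell 2 × ℤ | ∃ Y ∈ P, dist X Y ≤ 1}
    have hnn := nnFormZ_nonneg (extP hP.toFinset g)
    have hnonpos : ∑ X ∈ hP.toFinset, ⟪truncResidual ϱ a b w (extP hP.toFinset g) X, extP hP.toFinset g X.1 X.2⟫_ℝ ≤ 0 := by
      nlinarith [hk, hnn, hκ₀]
    rw [abs_of_nonpos hnonpos]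
    calc κ₀ / 2 * idxEnergy (extP hP.toFinset g) {X : Cell 2 × ℤ | ∃ Y ∈ P, dist X Y ≤ 1}
        ≤ κ₀ / 2 * nnFormZ (extP hP.toFinset g) := mul_le_mul_of_nonneg_left hidx (by positivity)
      _ ≤ _ := hk

end DirichletSolve

end Summit.AtomisticToContinuum.Crystallization.Theorems.ChartedZeroExcessLayeredLatticeLiouville

end
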